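import Mathlib
import Summits.ValiantsHypothesis.ValiantsHypothesis.Theorems.NewtonTauWeak.Negative.Zonogon
import Summits.ValiantsHypothesis.ValiantsHypothesis.Theorems.NewtonUnitEquationsDissociatedUniformGreedyCharts
import Summits.ValiantsHypothesis.ValiantsHypothesis.Theorems.NewtonUnitEquationsNewtonTauWeakAutomatonGenDefs
import Summits.ValiantsHypothesis.ValiantsHypothesis.Theorems.NewtonUnitEquationsNewtonTauWeakAutomatonRadixDefs
import Summits.ValiantsHypothesis.ValiantsHypothesis.Theorems.NewtonUnitEquationsNewtonTauWeakAutomatonBoxGreedy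
import Summits.ValiantsHypothesis.ValiantsHypothesis.Theorems.NewtonUnitEquationsNewtonTauWeakAutomatonAnisoStep
import Summits.ValiantsHypothesis.ValiantsHypothesis.Theorems.NewtonUnitEquationsNewtonTauWeakAutomatonRadixCoeff
import Summits.ValiantsHypothesis.ValiantsHypothesis.Theorems.NewtonUnitEquationsNewtonTauWeakAutomatonRadixRecursion
import Summits.ValiantsHypothesis.ValiantsHypothesis.Theorems.NewtonUnitEquationsNewtonTauWeakAutomatonRadixSupport

/-!
# `NewtonUnitEquationsNewtonTauWeakAutomatonRadixAssembly` — THEOREM C: a K-UNIFORM quasi-polynomial vertex bound on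
# every mixed-radix digit frame with level polynomials of bounded degree (crux `NewtonTauWeak`,
# stmt-ValiantsHypothesis-5904; line `binomial-normal-form`, registered stub `stub_radAssembly`)

`stub_radAssembly`: for EVERY radix pair `bx, by ≥ 2`, every number `k` of products, every degree bound `C`, every
number `n` of levels, all scalars `c` and all level polynomials `G l i` of degree `≤ C` in each variable,
`vert( Σ_{l<k} c_l Π_{i<n} G_{l,i}(x^{bx^i}, y^{by^i}) ) ≤ (C+1)² · (bx·by) · A ^ ⌈log₂ n⌉`, `A = 4D³ + 2D² + 2D + 2`,
`D = d²`, `d = k (C+1)⁴` — the verbatim generalisation of THEOREM B (`stub_genAssembly`, `…AutomatonGenAssembly.lean`,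
radix `(2, 2)`) to an arbitrary radix pair `(bx, by)` (mixed radix: e.g. parabola digits `(2^i, 4^i)` with axis
digits are `(2, 4)`-automatic, base-`t` digit grids with multiplicity are `(t, t)`-automatic).
Proof (same assembly as Theorem B): the mixed-radix carry automaton (`stub_radCoeff`: the coefficient array of the
`k`-sum is a linear image of the `d`-dimensional vector configuration `radVecFin`, `coeff_radSum_eq`), top survivors
are greedy in a box with general moduli (`stub_boxGreedy`: `vert ≤ (C+1)²·|cshadow|`, with the support bound
`stub_radSupport`), bilinear self-similarity (`stub_radRecursion`) and Theorem Q's product step with anisotropic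
scaling (`stub_anisoStep`) give the shadow recursion `s(h+m) ≤ 2D²(D s(m) + D s(h) + 1) + 2D + 1`
(`rad_shadow_step`), and halving (`Nat.clog`) closes (`rad_shadow_bound`; base case `n ≤ 1`: the shadow lies in the
box `[0, bx^n) × [0, by^n)` of at most `bx·by` points, which is why `bx·by` replaces Theorem B's `4`; the induction
hypothesis is quantified over all level polynomials, so the shifted polynomials `shiftLev G h` of the high factor
need no separate treatment). [folklore: Theorem Q for tensor trains, mixed radix]
-/

set_option linter.dupNamespace false

noncomputable section

open scoped BigOperators
open MvPolynomial
open Summit.ValiantsHypothesis.ValiantsHypothesis.Theorems.NewtonTauWeak.Negative (vert)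
open Summit.ValiantsHypothesis.ValiantsHypothesis.Theorems.NewtonUnitEquationsDissociatedUniform (QuasiPoly.cshadow
  QuasiPoly.cshadow_subset QuasiPoly.cshadow_finite)

namespace Summit.ValiantsHypothesis.ValiantsHypothesis.Theorems.NewtonTauWeakAutomaton

namespace RadAssemblyAux

/-! ## The shadow recursion of the level-`n` configuration (no new definitions: everything inlined) -/

-- adapted from NewtonUnitEquationsNewtonTauWeakAutomatonGenAssembly.lean (Theorem B, `gen_shadow_le_card` …
-- `gen_shadow_bound`, radix `(2, 2)`)

/-- Trivial bound: the shadow of the mixed-radix configuration lies in the box `[0, bx^n) × [0, by^n)`, which has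
`bx^n · by^n` points (`card_radBox`). -/
theorem rad_shadow_le_card (bx by' k C n : ℕ) (G : Fin k → ℕ → MvPolynomial (Fin 2) ℂ) :
    (QuasiPoly.cshadow (radBox bx by' n) (radVecFin bx by' k C G 0 n) (fun P => ((P.1 : ℕ) : ℝ))
        (fun P => ((P.2 : ℕ) : ℝ))).ncard ≤
      bx ^ n * by' ^ n := by
  rw [← card_radBox bx by' n, ← Set.ncard_coe_finset]
  exact Set.ncard_le_ncard (QuasiPoly.cshadow_subset _ _ _ _) (Finset.finite_toSet _)

/-- The product step specialised to the mixed-radix automaton (`stub_anisoStep` + `stub_radRecursion`):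
`s(h+m) ≤ 2D²(D·s_high(m) + D·s_low(h) + 1) + 2D + 1`, `D = d²`, `d = k (C+1)⁴`; the high factor is the level-`m`
configuration of the shifted level polynomials `shiftLev G h`, its box `[0, bx^m) × [0, by^m)` scaled anisotropically
by `(bx^h, by^h)`. -/
theorem rad_shadow_step (bx by' k C h m : ℕ) (hbx : 2 ≤ bx) (hby : 2 ≤ by') (G : Fin k → ℕ → MvPolynomial (Fin 2) ℂ)
    (D : ℕ) (hD : D = k * ((C + 1) * (C + 1) * ((C + 1) * (C + 1))) * (k * ((C + 1) * (C + 1) * ((C + 1) * (C + 1))))) :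
    (QuasiPoly.cshadow (radBox bx by' (h + m)) (radVecFin bx by' k C G 0 (h + m)) (fun P => ((P.1 : ℕ) : ℝ))
        (fun P => ((P.2 : ℕ) : ℝ))).ncard ≤
      2 * (D * D * (D * (QuasiPoly.cshadow (radBox bx by' m) (radVecFin bx by' k C (shiftLev G h) 0 m)
              (fun P => ((P.1 : ℕ) : ℝ)) (fun P => ((P.2 : ℕ) : ℝ))).ncard +
            D * (QuasiPoly.cshadow (radBox bx by' h) (radVecFin bx by' k C G 0 h) (fun P => ((P.1 : ℕ) : ℝ))
              (fun P => ((P.2 : ℕ) : ℝ))).ncard + 1)) +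
        D + D + 1 := by
  subst hD
  refine stub_anisoStep (bx ^ h) (by' ^ h) (bx ^ m) (by' ^ m) (Nat.one_le_pow _ _ (by omega))
    (Nat.one_le_pow _ _ (by omega)) (radBox bx by' (h + m)) (radBox bx by' m) (radBox bx by' h)
    (by rw [radBox, pow_add, pow_add]) rfl rfl (radVecFin bx by' k C G 0 (h + m))
    (radVecFin bx by' k C (shiftLev G h) 0 m) (radVecFin bx by' k C G 0 h) (genContract k C) ?_
  intro H _ L hL
  have hL' : L.1 < bx ^ h ∧ L.2 < by' ^ h := by
    simpa [radBox, Finset.mem_product, Finset.mem_range] using hL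
  exact stub_radRecursion bx by' k C h m hbx hby G H L hL'

/-- **The shadow recursion, solved by halving**: with `A = 4D³ + 2D² + 2D + 2`, `D = d²`, `d = k (C+1)⁴`, the level-`n`
mixed-radix configuration has at most `bx · by · A^{⌈log₂ n⌉}` greedy positions, for ALL level polynomials `G` (so that
the induction hypothesis applies to the shifted polynomials of the high factor); the base case `n ≤ 1` is the whole
box, `bx^n · by^n ≤ bx · by` points. [folklore] -/
theorem rad_shadow_bound (bx by' k C : ℕ) (hbx : 2 ≤ bx) (hby : 2 ≤ by') :
    ∀ n (G : Fin k → ℕ → MvPolynomial (Fin 2) ℂ),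
    (QuasiPoly.cshadow (radBox bx by' n) (radVecFin bx by' k C G 0 n) (fun P => ((P.1 : ℕ) : ℝ))
        (fun P => ((P.2 : ℕ) : ℝ))).ncard ≤
      bx * by' *
        (4 * (k * ((C + 1) * (C + 1) * ((C + 1) * (C + 1))) * (k * ((C + 1) * (C + 1) * ((C + 1) * (C + 1))))) ^ 3 +
          2 * (k * ((C + 1) * (C + 1) * ((C + 1) * (C + 1))) * (k * ((C + 1) * (C + 1) * ((C + 1) * (C + 1))))) ^ 2 +
          2 * (k * ((C + 1) * (C + 1) * ((C + 1) * (C + 1))) * (k * ((C + 1) * (C + 1) * ((C + 1) * (C + 1))))) + 2) ^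
        Nat.clog 2 n := by
  intro n
  induction n using Nat.strong_induction_on with
  | _ n ih =>
    intro G
    set D : ℕ := k * ((C + 1) * (C + 1) * ((C + 1) * (C + 1))) * (k * ((C + 1) * (C + 1) * ((C + 1) * (C + 1))))
      with hD
    set A : ℕ := 4 * D ^ 3 + 2 * D ^ 2 + 2 * D + 2 with hA
    rcases Nat.lt_or_ge n 2 with hn | hn
    · -- n = 0 or 1: the whole box has ≤ bx · by points
      have hclog : Nat.clog 2 n = 0 := Nat.clog_of_right_le_one (by omega) 2
      rw [hclog, pow_zero, mul_one]
      refine (rad_shadow_le_card bx by' k C n G).trans ?_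
      interval_cases n
      · rw [pow_zero, pow_zero]
        exact Nat.mul_le_mul (by omega) (by omega)
      · rw [pow_one, pow_one]
    · -- split n = h + m with h = n / 2, m = (n + 1) / 2
      set m : ℕ := (n + 1) / 2 with hm
      set h : ℕ := n / 2 with hh
      have hhm : h + m = n := by omega
      have hm_lt : m < n := by omega
      have hh_lt : h < n := by omega
      have hclog : Nat.clog 2 n = Nat.clog 2 m + 1 := by
        rw [Nat.clog_of_two_le (by norm_num) hn]
        have hm' : (n + 2 - 1) / 2 = m := by omega
        rw [hm']
      have hclog_h : Nat.clog 2 h ≤ Nat.clog 2 m := Nat.clog_mono_right 2 (by omega)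
      have ihm := ih m hm_lt (shiftLev G h)
      have ihh := ih h hh_lt G
      have step := rad_shadow_step bx by' k C h m hbx hby G D hD
      rw [hhm] at step
      set c := Nat.clog 2 m with hc
      have hA1 : 1 ≤ A := by rw [hA]; omega
      have hpow : 1 ≤ A ^ c := Nat.one_le_pow _ _ hA1
      have hB1 : 1 ≤ bx * by' := Nat.mul_le_mul (by omega : 1 ≤ bx) (by omega : 1 ≤ by')
      have ihh' : (QuasiPoly.cshadow (radBox bx by' h) (radVecFin bx by' k C G 0 h) (fun P => ((P.1 : ℕ) : ℝ))
          (fun P => ((P.2 : ℕ) : ℝ))).ncard ≤ bx * by' * A ^ c :=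
        ihh.trans (Nat.mul_le_mul_left _ (Nat.pow_le_pow_right hA1 hclog_h))
      rw [hclog, pow_succ]
      set S := A ^ c with hS
      set T := bx * by' * S with hT
      have hT1 : 1 ≤ T := by
        rw [hT]
        exact Nat.mul_le_mul hB1 hpow
      set sm := (QuasiPoly.cshadow (radBox bx by' m) (radVecFin bx by' k C (shiftLev G h) 0 m)
        (fun P => ((P.1 : ℕ) : ℝ)) (fun P => ((P.2 : ℕ) : ℝ))).ncard with hsm
      set sh := (QuasiPoly.cshadow (radBox bx by' h) (radVecFin bx by' k C G 0 h) (fun P => ((P.1 : ℕ) : ℝ))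
        (fun P => ((P.2 : ℕ) : ℝ))).ncard with hsh
      have e1 : sm ≤ T := ihm
      have e2 : sh ≤ T := ihh'
      calc (QuasiPoly.cshadow (radBox bx by' n) (radVecFin bx by' k C G 0 n) (fun P => ((P.1 : ℕ) : ℝ))
              (fun P => ((P.2 : ℕ) : ℝ))).ncard
          ≤ 2 * (D * D * (D * sm + D * sh + 1)) + D + D + 1 := step
        _ ≤ 2 * (D * D * (D * T + D * T + 1)) + D + D + 1 := by gcongr
        _ ≤ T * A := by
            rw [hA]
            nlinarith [hT1, Nat.zero_le D, Nat.zero_le (D * D), Nat.zero_le (D * D * D), Nat.zero_le T,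
              Nat.mul_le_mul_left (D * D) hT1, Nat.mul_le_mul_left D hT1]
        _ = bx * by' * (S * A) := by rw [hT]; ring

/-! ## The coefficient array of the `k`-sum is a linear image of the configuration -/

/-- **The coefficient of the `k`-sum at `(bx^n t₁ + P₁, by^n t₂ + P₂)` is a fixed linear functional (depending on the
final carry `t ∈ {0, …, C}²`) of the configuration vector at `P`.** [folklore: `stub_radCoeff`] -/
theorem coeff_radSum_eq (bx by' k C n : ℕ) (hbx : 2 ≤ bx) (hby : 2 ≤ by') (c : Fin k → ℂ)
    (G : Fin k → ℕ → MvPolynomial (Fin 2) ℂ) (hG : ∀ l i, ∀ e ∈ (G l i).support, e 0 ≤ C ∧ e 1 ≤ C)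
    (t : Fin (C + 1) × Fin (C + 1)) (P : ℕ × ℕ) (hP : P ∈ radBox bx by' n) :
    coeff (Finsupp.single 0 (bx ^ n * (t.1 : ℕ) + P.1) + Finsupp.single 1 (by' ^ n * (t.2 : ℕ) + P.2))
        (radSum bx by' k n c G) =
      (∑ l : Fin k, c l • LinearMap.proj (R := ℂ)
          (φ := fun _ : Fin (k * ((C + 1) * (C + 1) * ((C + 1) * (C + 1)))) => ℂ)
          (gidxEquiv k C (l, (((0 : Fin (C + 1)), (0 : Fin (C + 1))), t)))) (radVecFin bx by' k C G 0 n P) := by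
  have hP' : P.1 < bx ^ n ∧ P.2 < by' ^ n := by
    simpa [radBox, Finset.mem_product, Finset.mem_range] using hP
  unfold radSum
  rw [coeff_sum, LinearMap.sum_apply]
  refine Finset.sum_congr rfl fun l _ => ?_
  rw [coeff_C_mul, LinearMap.smul_apply, LinearMap.proj_apply, smul_eq_mul]
  congr 1
  rw [stub_radCoeff bx by' C hbx hby (G l) (hG l) n t P hP']
  simp [radVecFin, radVec]

end RadAssemblyAux

open RadAssemblyAux

/-! ## THEOREM C -/

/-- **THEOREM C (K-uniform quasi-polynomial bound on every mixed-radix digit frame with bounded level degree).** For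
EVERY radix pair `bx, by ≥ 2`, every number `k` of products, every degree bound `C`, every `n`, all scalars `c` and all
level polynomials `G l i` of degree `≤ C` in each variable, the Newton polygon of
`radSum bx by k n c G = Σ_{l<k} c_l Π_{i<n} G_{l,i}(x^{bx^i}, y^{by^i})` has at most `(C+1)² · (bx·by) · A^{⌈log₂ n⌉}`
vertices, `A = 4D³ + 2D² + 2D + 2`, `D = (k (C+1)⁴)²` — i.e. `n^{O(log (k (C+1)))}`, uniformly in `k` and in the radix
pair (the generalisation of Theorem B, `stub_genAssembly`, from radix `(2, 2)` to every radix pair; the base case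
`n ≤ 1` is the box itself, `bx·by` points, which is why `bx·by` replaces Theorem B's `4`).  Proof: `stub_boxGreedy`
(vertices are greedy positions, `vert ≤ (C+1)²·|cshadow|`, moduli `bx^n, by^n`) with the linear coefficient
functionals of `coeff_radSum_eq` (`stub_radCoeff`) and the support bound `stub_radSupport`, then `rad_shadow_bound`
(`stub_anisoStep` + `stub_radRecursion`, halving).
[folklore: mixed-radix carry automaton + Theorem Q's greedy-shadow product step ("Theorem Q for tensor trains")] -/
theorem stub_radAssembly (bx by' k C n : ℕ) (hbx : 2 ≤ bx) (hby : 2 ≤ by') (c : Fin k → ℂ)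
    (G : Fin k → ℕ → MvPolynomial (Fin 2) ℂ) (hG : ∀ l i, ∀ e ∈ (G l i).support, e 0 ≤ C ∧ e 1 ≤ C) :
    vert (radSum bx by' k n c G) ≤ (C + 1) * (C + 1) * (bx * by' *
      (4 * (k * ((C + 1) * (C + 1) * ((C + 1) * (C + 1))) * (k * ((C + 1) * (C + 1) * ((C + 1) * (C + 1))))) ^ 3 +
        2 * (k * ((C + 1) * (C + 1) * ((C + 1) * (C + 1))) * (k * ((C + 1) * (C + 1) * ((C + 1) * (C + 1))))) ^ 2 +
        2 * (k * ((C + 1) * (C + 1) * ((C + 1) * (C + 1))) * (k * ((C + 1) * (C + 1) * ((C + 1) * (C + 1))))) + 2) ^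
      Nat.clog 2 n) := by
  have h1 := stub_boxGreedy C (bx ^ n) (by' ^ n) (radBox bx by' n) rfl (radSum bx by' k n c G)
    (radVecFin bx by' k C G 0 n)
    (fun t => ∑ l : Fin k, c l • LinearMap.proj (R := ℂ)
      (φ := fun _ : Fin (k * ((C + 1) * (C + 1) * ((C + 1) * (C + 1)))) => ℂ)
      (gidxEquiv k C (l, (((0 : Fin (C + 1)), (0 : Fin (C + 1))), t))))
    (stub_radSupport bx by' k C n hbx hby c G hG) (fun t P hP => coeff_radSum_eq bx by' k C n hbx hby c G hG t P hP)
  exact h1.trans (Nat.mul_le_mul_left _ (rad_shadow_bound bx by' k C hbx hby n G))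

end Summit.ValiantsHypothesis.ValiantsHypothesis.Theorems.NewtonTauWeakAutomaton

end
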